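import Summits.BirchSwinnertonDyer.BirchSwinnertonDyer.Theorems.ManinLocalTwoThreeBlindFamilyReductions
import Summits.BirchSwinnertonDyer.BirchSwinnertonDyer.Theorems.EisensteinDepletionAtTwoStarPrimeLevelModels
import HarnessLib
import HarnessLib.Audit.Tags

/-!
# E-an-103♭ `BlindFamilyTorsionLaw` IS A THEOREM: `E′_m(ℚ)_tors = {O, (0,0)}` for odd `|m| ≥ 3`, `m² + 4` prime
# (cell `bsd-f2-manin`, crux C2 `ManinOddAtFour` stmt-BirchSwinnertonDyer-22967 — the blind TAME residual of line
# `kato_shift_two` IS this family; an's THEOREM TARGET of `BlindFamilyBSDTwo.lean`, MEMO-an §65; C2/C3 LEAD p1 gen 8)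

Summit `BirchSwinnertonDyer`, route `ManinLocalTwoThree`.  The typed row E-an-103♭
`Summit.BirchSwinnertonDyer.Rank1Residual.ManinAdditive.BlindFamilyTorsionLaw` («PAPER THEOREM — Lutz–Nagell; theorem target;
nothing asserted», refuter-1 §R68 SURVIVES) is discharged here BY NAME (PART B: steps 3–4; steps 1–2 — global minimality and the reductions at `3`, `5` — are the sibling `…BlindFamilyReductions.lean`, PART A) for the blind family
`E′_m = ShimuraLedger.blindCurve m : y² = x³ − 2m x² + (m² + 4) x`:
for odd `m` with `3 ≤ |m|` and `p = m² + 4` prime, `#E′_m(ℚ)_tors = 2`.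

## Proof (Knapp's route for `y² = x³ + Ax`, as the tree's `CongruentNumberCurveTorsionProofs`, with two fixed good primes)

1. `E′_m` is its own global minimal model (`isGloballyMinimal_of_int_criterion`: `Δ = −2⁸p²`, `c₄ = 2⁴(m² − 12)`; `2¹² ∤ Δ`
   because `p` is odd, and an odd prime `q` with `q ∣ Δ`, `q ∣ c₄` would divide `(m² + 4) − (m² − 12) = 16`).
2. `3 ∤ Δ` and `5 ∤ Δ` (`p ≡ m² + 1 ≢ 0 (3)`; `5 ∣ m² + 4` forces `p = 5`, `|m| = 1`), and the reductions are read off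
   `m mod 3`, `m mod 5`: `#Ẽ′_m(𝔽₃) ∈ {4, 6, 2}`, `#Ẽ′_m(𝔽₅) ∈ {8, 4}` (kernel point counts of the six residue curves,
   `Supersingular.natCard_point_eq_of_countPoints`).  Hence every rational torsion point has order dividing `4`
   (`addOrderOf_dvd_reductionPointCount` at `3` and `5`, Silverman VII.3.1(b)).
3. No rational point of order `4` (duplication formula, Silverman III.2.3(d)): `2P = (x₂, 0)` forces `x₂ = 0`
   (`x² − 2mx + p = (x − m)² + 4 > 0`), and then `4y²·x₂ = (x² − p)²` gives `x² = p` — impossible, `√p ∉ ℚ`.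
4. So every torsion point is killed by `2`, i.e. is `O` or `(0, 0)`: `#E′_m(ℚ)_tors = 2`.

HONEST FRAMING: an elementary arithmetic theorem about an explicit family; it retires one typed «paper theorem» row of the
cell (E-an-103♭) and, with E-an-103♯ (Tamagawa law, still open), gives the support row E-an-103 `BlindFamilyLocalTerms` used
by the family-level cusp criterion E-an-104/105.  Nothing here bears on BSD or proves Manin's conjecture; C2 stays OPEN.

References: [Knapp1993] Ch. V Thm. 5.1(c), 5.2 (PDF pp. 97, 101, 112); [SilvermanAEC2009] III.2.3(d), VII.1 Rem. 1.1,
VII.3.1(b); cell memo MEMO-an §65 (census g23: 1485/1485).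
-/

set_option autoImplicit false
-- `Summit.BirchSwinnertonDyer.BirchSwinnertonDyer` is the mandated summit-side namespace (single-conjunct summit).
set_option linter.dupNamespace false

noncomputable section

open scoped Classical

open WeierstrassCurve Literature.NumberTheory.EllipticCurves
  Literature.NumberTheory.EllipticCurves.Rank1Residual.X11RankOneCertificates
  Summit.BirchSwinnertonDyer.Rank1Residual.ManinAdditive
  Summit.BirchSwinnertonDyer.Rank1Residual.ManinAdditive.ShimuraLedger
  Summit.BirchSwinnertonDyer.Rank1Residual.ManinAdditive.BlindFamilyDescent
  Summit.BirchSwinnertonDyer.Rank1Residual.Supersingular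
  Summit.BirchSwinnertonDyer.BirchSwinnertonDyer.Rank1Residual.IntModel
  Summit.BirchSwinnertonDyer.BirchSwinnertonDyer.Rank1Residual.X11RankOne

namespace Summit.BirchSwinnertonDyer.BirchSwinnertonDyer.Theorems.ManinLocalTwoThree

/-! ### §3 No rational point of order `4` -/

/-- **No rational point of `E′_m` has order `4`** (`p = m² + 4` prime): `2P` would be the unique rational `2`-torsion point
`(0, 0)`, and the duplication formula then gives `x(P)² = p`. [cite: SilvermanAEC2009, III.2.3(d)] [cite: Knapp1993, Thm. 5.2] -/
theorem not_addOrderOf_eq_four_blindCurve {m : ℤ} {p : ℕ} (hp : p.Prime) (hpm : (p : ℤ) = m ^ 2 + 4)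
    (P : (blindCurve m).toAffine.Point) : addOrderOf P ≠ 4 := by
  intro h4
  have hpQ : ((m : ℚ) ^ 2 + 4) = (p : ℚ) := by exact_mod_cast hpm.symm
  -- `2 • P ≠ 0` and `2 • (2 • P) = 0`
  have h2P_ne : (2 : ℕ) • P ≠ 0 :=
    nsmul_ne_zero_of_lt_addOrderOf (by norm_num) (by rw [h4]; norm_num)
  have h4P : (2 : ℕ) • ((2 : ℕ) • P) = 0 := by
    rw [← mul_nsmul, show 2 * 2 = addOrderOf P by rw [h4]]
    exact addOrderOf_nsmul_eq_zero P
  rcases P with _ | ⟨x, y, hP⟩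
  · exact h2P_ne (nsmul_zero 2)
  have ha₁ : (blindCurve m).toAffine.a₁ = 0 := rfl
  have ha₂ : (blindCurve m).toAffine.a₂ = -2 * m := rfl
  have ha₃ : (blindCurve m).toAffine.a₃ = 0 := rfl
  have ha₄ : (blindCurve m).toAffine.a₄ = (m : ℚ) ^ 2 + 4 := rfl
  have ha₆ : (blindCurve m).toAffine.a₆ = 0 := rfl
  have hnegY : ∀ u v : ℚ, (blindCurve m).toAffine.negY u v = -v := by
    intro u v; rw [Affine.negY, ha₁, ha₃]; ring
  have hPeq : y ^ 2 = x ^ 3 - 2 * m * x ^ 2 + ((m : ℚ) ^ 2 + 4) * x := by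
    have := (Affine.equation_iff x y).mp hP.left
    rw [ha₁, ha₂, ha₃, ha₄, ha₆] at this
    linear_combination this
  have hy : y ≠ (blindCurve m).toAffine.negY x y := by
    intro hy
    exact h2P_ne (by rw [two_nsmul]; exact Affine.Point.add_self_of_Y_eq hy)
  have hy0 : y ≠ 0 := by
    intro h0; apply hy; rw [hnegY, h0, neg_zero]
  have hℓval : (blindCurve m).toAffine.slope x x y y * (2 * y) = 3 * x ^ 2 - 4 * m * x + ((m : ℚ) ^ 2 + 4) := by
    rw [(blindCurve m).toAffine.slope_of_Y_ne rfl hy, hnegY, ha₁, ha₂, ha₄]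
    field_simp
    ring
  have hx₂val : (blindCurve m).toAffine.addX x x ((blindCurve m).toAffine.slope x x y y) =
      (blindCurve m).toAffine.slope x x y y ^ 2 + 2 * m - 2 * x := by
    rw [Affine.addX, ha₁, ha₂]; ring
  have hQns : (blindCurve m).toAffine.Nonsingular
      ((blindCurve m).toAffine.addX x x ((blindCurve m).toAffine.slope x x y y))
      ((blindCurve m).toAffine.addY x x y ((blindCurve m).toAffine.slope x x y y)) :=
    Affine.nonsingular_add hP hP fun hxy => hy hxy.right
  have hsum : (2 : ℕ) • (Affine.Point.some x y hP) = Affine.Point.some _ _ hQns := by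
    rw [two_nsmul]; exact Affine.Point.add_self_of_Y_ne hy
  generalize (blindCurve m).toAffine.slope x x y y = ℓ at hℓval hx₂val hQns hsum
  generalize (blindCurve m).toAffine.addX x x ℓ = x₂ at hx₂val hQns hsum
  generalize (blindCurve m).toAffine.addY x x y ℓ = y₂ at hQns hsum
  -- `y₂ = 0`
  have hy₂0 : y₂ = 0 := by
    by_contra hne
    have hne' : y₂ ≠ (blindCurve m).toAffine.negY x₂ y₂ := by
      rw [hnegY]; intro h; apply hne; linarith
    have hQQ := Affine.Point.add_self_of_Y_ne (h₁ := hQns) hne'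
    apply Affine.Point.some_ne_zero (Affine.nonsingular_add hQns hQns fun hxy => hne' hxy.right)
    rw [← hQQ, ← two_nsmul, ← hsum]
    exact h4P
  -- the equation of `2 • P`: `x₂ (x₂² − 2m x₂ + p) = 0`, and the quadratic factor is positive
  have hx₂0 : x₂ = 0 := by
    have := (Affine.equation_iff x₂ y₂).mp hQns.left
    rw [ha₁, ha₂, ha₃, ha₄, ha₆, hy₂0] at this
    have hfac : x₂ * ((x₂ - m) ^ 2 + 4) = 0 := by linear_combination -this
    rcases mul_eq_zero.mp hfac with h | h
    · exact h
    · exfalso; nlinarith [sq_nonneg (x₂ - m)]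
  -- duplication: `4 y² x₂ = (x² − p)²`
  have key : (x ^ 2 - ((m : ℚ) ^ 2 + 4)) ^ 2 = 0 := by
    have e : 4 * y ^ 2 * x₂ = (x ^ 2 - ((m : ℚ) ^ 2 + 4)) ^ 2 := by
      have h1 : 4 * y ^ 2 * x₂ = (ℓ * (2 * y)) ^ 2 + 4 * y ^ 2 * (2 * m - 2 * x) := by rw [hx₂val]; ring
      rw [h1, hℓval, hPeq]
      ring
    rw [← e, hx₂0, mul_zero]
  have hx : x ^ 2 = (p : ℚ) := by
    rw [← hpQ]
    have := pow_eq_zero_iff (n := 2) (by norm_num) |>.mp key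
    linear_combination this
  exact DepletionAtTwo.not_sq_eq_prime hp x hx

/-! ### §4 Every torsion point is killed by `2`; the torsion subgroup is `{O, (0,0)}` -/

/-- **`2 • T = 0` for every rational torsion point of `E′_m`** (odd `m`, `3 ≤ |m|`, `m² + 4` prime): the order divides
`#Ẽ′_m(𝔽₃) ∈ {4, 6, 2}` and `#Ẽ′_m(𝔽₅) ∈ {8, 4}`, hence divides `4`, and is not `4`.
[cite: SilvermanAEC2009, VII.3.1(b)] [cite: Knapp1993, Ch. V §6, proof of Thm. 5.2] -/
theorem two_nsmul_eq_zero_of_isOfFinAddOrder_blindCurve {m : ℤ} {p : ℕ} (hp : p.Prime) (hpm : (p : ℤ) = m ^ 2 + 4)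
    (hm : Odd m) (h3 : 3 ≤ |m|) {T : (blindCurve m).toAffine.Point} (hT : IsOfFinAddOrder T) : (2 : ℕ) • T = 0 := by
  haveI := isGloballyMinimal_blindCurve hm
  haveI : (blindCurve m).IsElliptic := OddDegreeTooth.isElliptic_blindCurve m
  haveI : Fact (Nat.Prime 3) := ⟨Nat.prime_three⟩
  haveI : Fact (Nat.Prime 5) := ⟨by norm_num⟩
  -- `3 ∤ m² + 4` and `5 ∤ m² + 4`
  have h3p : ¬ ((3 : ℕ) : ℤ) ∣ m ^ 2 + 4 := by
    intro h
    have h' : ((m : ZMod 3)) ^ 2 + 4 = 0 := by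
      have := (ZMod.intCast_zmod_eq_zero_iff_dvd (m ^ 2 + 4) 3).mpr (by exact_mod_cast h)
      push_cast at this; exact this
    have hcases := zmod3_sq_add_four_ne_zero
    exact hcases _ h'
  have h5p : ¬ ((5 : ℕ) : ℤ) ∣ m ^ 2 + 4 := by
    intro h
    -- `5 ∣ p` with `p` prime ⟹ `p = 5` ⟹ `m² = 1` ⟹ `|m| = 1`
    have h5 : (5 : ℤ) ∣ (p : ℤ) := by rw [hpm]; exact_mod_cast h
    have h5' : 5 ∣ p := by exact_mod_cast h5
    have hp5 : p = 5 := ((Nat.prime_dvd_prime_iff_eq (by norm_num) hp).mp h5').symm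
    rw [hp5] at hpm
    have hm1 : (m - 1) * (m + 1) = 0 := by linear_combination hpm.symm
    rcases mul_eq_zero.mp hm1 with h | h
    · have hm' : m = 1 := by linarith
      rw [hm'] at h3; norm_num at h3
    · have hm' : m = -1 := by linarith
      rw [hm'] at h3; norm_num at h3
  set n := addOrderOf T with hn
  have hd3 : n ∣ (blindCurve m).reductionPointCount 3 :=
    addOrderOf_dvd_reductionPointCount (blindCurve m) 3 le_rfl
      (not_dvd_minimalDiscriminantInt_blindCurve hm Nat.prime_three (by norm_num) h3p) hT
  have hd5 : n ∣ (blindCurve m).reductionPointCount 5 :=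
    addOrderOf_dvd_reductionPointCount (blindCurve m) 5 (by norm_num)
      (not_dvd_minimalDiscriminantInt_blindCurve hm (by norm_num) (by norm_num) h5p) hT
  -- `n ∣ 4`
  have hn4 : n ∣ 4 := by
    rcases reductionPointCount_blindCurve_three hm with h | h | h
    · rw [h] at hd3; exact hd3
    · rw [h] at hd3
      rcases reductionPointCount_blindCurve_five hm h5p with h' | h'
      · rw [h'] at hd5
        have := Nat.dvd_gcd hd3 hd5
        exact this.trans (by norm_num)
      · rw [h'] at hd5; exact hd5
    · rw [h] at hd3; exact hd3.trans (by norm_num)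
  -- `n ≠ 4`, so `n ∣ 2`
  have hn2 : n ∣ 2 := by
    have hne : n ≠ 4 := not_addOrderOf_eq_four_blindCurve hp hpm T
    rcases (Nat.dvd_prime_pow Nat.prime_two).mp (show n ∣ 2 ^ 2 by simpa using hn4) with ⟨k, hk, hnk⟩
    interval_cases k
    · simp [hnk]
    · simp [hnk]
    · exact absurd hnk (by simpa using hne)
  exact addOrderOf_dvd_iff_nsmul_eq_zero.mp hn2

/-- The rational point `(0, 0)` of `E′_m`. [folklore] -/
theorem nonsingular_zero_zero_blindCurve (m : ℤ) : (blindCurve m).toAffine.Nonsingular 0 0 := by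
  haveI : (blindCurve m).IsElliptic := OddDegreeTooth.isElliptic_blindCurve m
  refine (Affine.equation_iff_nonsingular (W := (blindCurve m).toAffine)).mp ?_
  rw [Affine.equation_iff]
  simp [blindCurve]

/-- A point of `E′_m` killed by `2` is `O` or `(0, 0)`: the other roots of `x (x² − 2mx + m² + 4)` are not real. [folklore] -/
theorem eq_zero_or_eq_of_two_nsmul_eq_zero_blindCurve (m : ℤ) {T : (blindCurve m).toAffine.Point}
    (hT : (2 : ℕ) • T = 0) : T = 0 ∨ T = Affine.Point.some 0 0 (nonsingular_zero_zero_blindCurve m) := by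
  rcases T with _ | ⟨x, y, hP⟩
  · exact Or.inl rfl
  right
  have ha₁ : (blindCurve m).toAffine.a₁ = 0 := rfl
  have ha₂ : (blindCurve m).toAffine.a₂ = -2 * m := rfl
  have ha₃ : (blindCurve m).toAffine.a₃ = 0 := rfl
  have ha₄ : (blindCurve m).toAffine.a₄ = (m : ℚ) ^ 2 + 4 := rfl
  have ha₆ : (blindCurve m).toAffine.a₆ = 0 := rfl
  have hnegY : (blindCurve m).toAffine.negY x y = -y := by rw [Affine.negY, ha₁, ha₃]; ring
  -- `y = -y`: otherwise `P + P ≠ 0`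
  have hy : y = 0 := by
    by_contra hne
    have hne' : y ≠ (blindCurve m).toAffine.negY x y := by rw [hnegY]; intro h; apply hne; linarith
    apply Affine.Point.some_ne_zero (Affine.nonsingular_add hP hP fun hxy => hne' hxy.right)
    rw [← Affine.Point.add_self_of_Y_ne hne', ← two_nsmul]
    exact hT
  have hx : x = 0 := by
    have := (Affine.equation_iff x y).mp hP.left
    rw [ha₁, ha₂, ha₃, ha₄, ha₆, hy] at this
    have hfac : x * ((x - m) ^ 2 + 4) = 0 := by linear_combination -this
    rcases mul_eq_zero.mp hfac with h | h
    · exact h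
    · exfalso; nlinarith [sq_nonneg (x - m)]
  subst hx hy
  rfl

/-- Bookkeeping: `Nat.card E(ℚ)_tors` does not depend on the `DecidableEq ℚ` instance carried by Mathlib's group law
(as in `CongruentNumberCurveTorsionProofs`). [folklore] -/
private theorem blind_natCard_torsion_eq_of_subsingleton (W : WeierstrassCurve ℚ) (d₁ d₂ : DecidableEq ℚ) :
    Nat.card (@AddCommGroup.torsion _ (@WeierstrassCurve.Affine.Point.instAddCommGroup ℚ _ W.toAffine d₁)) =
      Nat.card (@AddCommGroup.torsion _ (@WeierstrassCurve.Affine.Point.instAddCommGroup ℚ _ W.toAffine d₂)) := by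
  obtain rfl : d₁ = d₂ := Subsingleton.elim _ _
  rfl

/-- **`#E′_m(ℚ)_tors = 2`** for odd `m` with `3 ≤ |m|` and `p = m² + 4` prime. [cite: Knapp1993, Thm. 5.2] -/
theorem torsionOrder_blindCurve {m : ℤ} {p : ℕ} (hp : p.Prime) (hpm : (p : ℤ) = m ^ 2 + 4) (hm : Odd m)
    (h3 : 3 ≤ |m|) : (blindCurve m).torsionOrder = 2 := by
  have h2 : Nat.card (AddCommGroup.torsion (blindCurve m).toAffine.Point) = 2 := by
    rw [Nat.card_eq_two_iff]
    set T₀ : (blindCurve m).toAffine.Point := Affine.Point.some 0 0 (nonsingular_zero_zero_blindCurve m) with hT₀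
    have hT₀2 : (2 : ℕ) • T₀ = 0 := by
      rw [two_nsmul]
      exact Affine.Point.add_self_of_Y_eq (by rw [Affine.negY]; simp [blindCurve])
    have hT₀tors : T₀ ∈ AddCommGroup.torsion (blindCurve m).toAffine.Point :=
      (AddCommGroup.mem_torsion T₀).mpr (isOfFinAddOrder_iff_nsmul_eq_zero.mpr ⟨2, two_pos, hT₀2⟩)
    refine ⟨⟨0, AddSubgroup.zero_mem _⟩, ⟨T₀, hT₀tors⟩, ?_, ?_⟩
    · intro h
      have := congrArg Subtype.val h
      exact Affine.Point.some_ne_zero _ this.symm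
    · ext ⟨T, hT⟩
      simp only [Set.mem_insert_iff, Set.mem_singleton_iff, Set.mem_univ, iff_true]
      have hfin : IsOfFinAddOrder T := (AddCommGroup.mem_torsion T).mp hT
      rcases eq_zero_or_eq_of_two_nsmul_eq_zero_blindCurve m
          (two_nsmul_eq_zero_of_isOfFinAddOrder_blindCurve hp hpm hm h3 hfin) with h | h
      · left; exact Subtype.ext h
      · right; exact Subtype.ext h
  unfold WeierstrassCurve.torsionOrder
  exact (blind_natCard_torsion_eq_of_subsingleton (blindCurve m) _ _).trans h2

/-- **E-an-103♭ `BlindFamilyTorsionLaw` (PROVED BY NAME).**  For odd `m` with `3 ≤ |m|` and `m² + 4` prime,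
`#E′_m(ℚ)_tors = 2`. [cite: Knapp1993, Ch. V Thm. 5.1(c) and Thm. 5.2] [cite: SilvermanAEC2009, III.2.3(d), VII.3.1(b)] -/
theorem blindFamilyTorsionLaw_holds : BlindFamilyTorsionLaw := by
  intro m hm h3 hprime
  have hpos : 0 < m ^ 2 + 4 := by positivity
  have hpm : (((m ^ 2 + 4).natAbs : ℕ) : ℤ) = m ^ 2 + 4 := Int.natAbs_of_nonneg hpos.le
  exact torsionOrder_blindCurve hprime hpm hm h3

end Summit.BirchSwinnertonDyer.BirchSwinnertonDyer.Theorems.ManinLocalTwoThree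

end
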